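import Mathlib
import Literature.Analysis.FluidPDE.WholeSpaceIBP
import Literature.Analysis.FluidPDE.WeakGradientIBP
import Literature.Analysis.FunctionSpaces.SobolevDomain
import HarnessLib

/-!
# A point is removable for weakly divergence-free `L²` fields (dimension `≥ 3`)

Analysis/FluidPDE support file. Let `E` be a finite-dimensional real inner product space of
dimension `d ≥ 3` with its Lebesgue (Haar) measure `volume`, and `V : E → E` a measurable field
with `|V|²` locally integrable. If `∫ ⟪V, ∇θ⟫ = 0` for every smooth `θ` compactly supported in the
punctured space `E ∖ {0}` (test functions `IsTestFunctionOn ⟨{x | x ≠ 0}, isOpen_ne⟩ θ` of the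
tree), then `∫ ⟪V, ∇θ⟫ = 0` for EVERY smooth compactly supported `θ`: the distribution `div V`,
which lies in `W^{-1,2}_loc`, cannot charge a single point, because a point has zero `2`-capacity
when `d ≥ 3` (Evans–Gariepy §4.7; Heinonen–Kilpeläinen–Martio Ch. 2). This is the step "the sink
is a removable point for the LINEAR (divergence) identity" in the point-sink constructions of the
anomalous-dissipation summit (route PointSink, stub `stub_freeSpaceSinkCompletion`: a velocity equal
to an `L²` self-similar cone near the sink, weakly divergence free off the sink, is weakly
divergence free on the whole space).

Proof (the standard cut-off argument, no capacity theory is formalised). With the tree's cut-off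
`χ_ε = cutoff ε` (`WholeSpaceIBP`: `= 1` on `B̄_ε`, `= 0` off `B_{2ε}`, `|∇χ_ε| ≤ C/ε`), the
function `(1 - χ_ε) θ` is an admissible test function off the origin, whence
`∫ ⟪V, ∇θ⟫ = ∫ (χ_ε Dθ·V + θ Dχ_ε·V)`. On `B̄_{2ε} ∖ {0}` one has `1/ε ≤ 2/|x|`, so the integrand is
dominated, uniformly in `0 < ε ≤ 1`, by the FIXED majorant
`H = G (1 + |V|²)/2 + C M (|V|² + |x|⁻²)` restricted to `B̄_{2ε}` (`G = sup ‖Dθ‖`, `M = sup |θ|`,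
`2|V|/|x| ≤ |V|² + |x|⁻²`); `|x|⁻² ∈ L¹_loc` exactly when `d ≥ 3` (Mathlib
`integrableOn_ball_of_norm_le_rpow`) — this is where the dimension enters, equivalently
`‖∇χ_ε‖²_{L²} = O(ε^{d-2})`. Finally `∫_{B̄_{2/(n+1)}} H → ∫_{⋂ₙ B̄_{2/(n+1)}} H = 0`
(`tendsto_setIntegral_of_antitone`; the intersection is the null set `{0}`). In `d = 2` the
statement is still true (logarithmic cut-offs) but is not proved here; in `d = 1` it is false
(`V = 1_{(0,∞)}`).

NOT claimed, and false in general: removability of a point for the QUADRATIC pairing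
`∫ ⟪U, Dw·U⟫` of an `L²` field `U` (the cut-off error `∫_{B_{2ε}} |U|² |∇χ_ε| |w|` need not vanish,
`|U|²` being only `L¹`); only the linear identity crosses a point for free.

* `integrable_inner_gradient` — `⟪V, ∇θ⟫ ∈ L¹` for `V ∈ L¹_loc`, `θ ∈ C¹_c`;
* `locallyIntegrable_of_normSq` — `|V|² ∈ L¹_loc ⇒ V ∈ L¹_loc`;
* `locallyIntegrable_of_puncture` — `L¹_loc` off the origin `+` integrable on a ball `⇒ L¹_loc`;
* `isTestFunctionOn_one_sub_cutoff_mul` — the cut-off test functions `(1 - χ_ε) θ` off the origin;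
* `integral_inner_gradient_eq_zero_of_puncture` — the removable-point theorem (`3 ≤ finrank ℝ E`,
  conclusion for `θ` given by `ContDiff ℝ ∞ θ`, `HasCompactSupport θ`);
* `isWeaklyDivFree_of_puncture` — the same with the tree predicate `IsWeaklyDivFree`;
* `integral_inner_gradient_eq_zero_of_puncture_three` — the `ℝ³` specialisation with the
  hypotheses in the form `|V|² ∈ L¹_loc(ℝ³ ∖ 0) ∧ |V|² ∈ L¹(B_r)`.

## Mathlib / tree search

Mathlib (this pin): no capacity theory and no removable-singularity lemma for distributions
(searched `removable`, `capacity`: none); used `integrableOn_ball_of_norm_le_rpow`,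
`tendsto_setIntegral_of_antitone`, `LocallyIntegrable.integrable_smul_left_of_hasCompactSupport`,
`IsAddHaarMeasure.nullSingletonClass`. Tree: `CollapseDebrisRegularity.isWeaklyDivFree_field`
(removable point for the SPECIFIC field `curl Φ`, `|Φ| ≲ |x|^{1-α}`, an `L¹`-type estimate; its
proof skeleton — cut-off family, fixed majorant on shrinking balls — is the pattern reused here),
the cut-off kit `cutoff`/`cutoff_eq_one`/`cutoff_eq_zero`/`exists_norm_fderiv_cutoff_le`
(`WholeSpaceIBP`, reused), `inner_gradient_eq_fderiv_apply` (`WeakGradientIBP`, reused),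
`IsWeaklyDivFree` (`VectorCalculus`). No duplicate (searched
`removable\|capacity\|weaklyDivFree_of\|of_puncture`, 2026-08-17). No definitions, no named facts.

## References

* L. C. Evans, R. F. Gariepy, *Measure Theory and Fine Properties of Functions*, CRC Press
  (1992), §4.7.2, Thm. 3 and Thm. 4 (a point has zero `p`-capacity for `p < n`; here `p = 2 < 3 ≤ n`).
* J. Heinonen, T. Kilpeläinen, O. Martio, *Nonlinear Potential Theory of Degenerate Elliptic
  Equations*, Oxford (1993), Ch. 2, §2.37–2.43 (sets of zero `p`-capacity are removable for the
  test class `W^{1,p}_0`).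
-/

noncomputable section

open MeasureTheory Filter Topology Set Metric Function
open scoped RealInnerProductSpace ContDiff

namespace Literature.Analysis.FluidPDE

variable {E : Type*} [NormedAddCommGroup E] [InnerProductSpace ℝ E] [FiniteDimensional ℝ E]
  [MeasurableSpace E] [BorelSpace E]

/-- `⟪V, ∇θ⟫ ∈ L¹` for `V ∈ L¹_loc` and `θ ∈ C¹_c`. [folklore] -/
theorem integrable_inner_gradient {V : E → E} (hV : LocallyIntegrable V volume) {θ : E → ℝ}
    (hθ : ContDiff ℝ 1 θ) (hθc : HasCompactSupport θ) :
    Integrable (fun x => ⟪V x, gradient θ x⟫) := by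
  have hg : Continuous (gradient θ) := continuous_gradient_of_contDiff hθ
  have hgc : HasCompactSupport (gradient θ) :=
    (hθc.fderiv (𝕜 := ℝ)).comp_left (g := (InnerProductSpace.toDual ℝ E).symm) (map_zero _)
  have hmaj : Integrable (fun x => ‖gradient θ x‖ • V x) :=
    hV.integrable_smul_left_of_hasCompactSupport hg.norm hgc.norm
  refine hmaj.mono (hV.aestronglyMeasurable.inner hg.aestronglyMeasurable)
    (Eventually.of_forall fun x => ?_)
  rw [norm_smul, norm_norm, mul_comm]
  exact norm_inner_le_norm _ _

/-- `|V|² ∈ L¹_loc ⇒ V ∈ L¹_loc` (for measurable `V`; `|V| ≤ 1 + |V|²`). [folklore] -/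
theorem locallyIntegrable_of_normSq {V : E → E} (hVm : AEStronglyMeasurable V volume)
    (hV2 : LocallyIntegrable (fun x => ‖V x‖ ^ 2) volume) : LocallyIntegrable V volume := by
  have h1 : LocallyIntegrable (fun x : E => (1 : ℝ) + ‖V x‖ ^ 2) volume :=
    (locallyIntegrable_const 1).add hV2
  refine h1.mono hVm (Eventually.of_forall fun x => ?_)
  rw [Real.norm_of_nonneg (by positivity)]
  nlinarith [sq_nonneg (‖V x‖ - 1), norm_nonneg (V x)]

/-- A function that is locally integrable on the punctured space `E ∖ {0}` and integrable on some
ball about the origin is locally integrable on `E`. [folklore] -/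
theorem locallyIntegrable_of_puncture {f : E → ℝ} {r : ℝ} (hr : 0 < r)
    (hloc : LocallyIntegrableOn f {x : E | x ≠ 0} volume)
    (hball : IntegrableOn f (ball (0 : E) r) volume) : LocallyIntegrable f volume := by
  intro x
  by_cases hx : x = 0
  · subst hx
    exact ⟨ball 0 r, ball_mem_nhds 0 hr, hball⟩
  · have h := hloc x hx
    rwa [isOpen_ne.nhdsWithin_eq hx] at h

omit [FiniteDimensional ℝ E] [MeasurableSpace E] [BorelSpace E] in
/-- For `ε > 0` and `θ ∈ C_c^∞(E)`, the function `(1 - χ_ε) θ` (`χ_ε = cutoff ε`, `= 1` on `B_ε`)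
is a test function on the punctured space `E ∖ {0}`. [folklore] -/
theorem isTestFunctionOn_one_sub_cutoff_mul {ε : ℝ} (hε : 0 < ε) {θ : E → ℝ}
    (hθ : ContDiff ℝ ∞ θ) (hθc : HasCompactSupport θ) :
    FunctionSpaces.IsTestFunctionOn ⟨{x : E | x ≠ 0}, isOpen_ne⟩
      (fun x => (1 - cutoff ε x) * θ x) := by
  refine ⟨(contDiff_const.sub (contDiff_cutoff ε)).mul hθ, hθc.mul_left, ?_⟩
  intro x hx
  change x ≠ 0
  rintro rfl
  have h0 : (fun x => (1 - cutoff ε x) * θ x) =ᶠ[𝓝 (0 : E)] 0 := by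
    filter_upwards [ball_mem_nhds (0 : E) hε] with y hy
    rw [mem_ball_zero_iff] at hy
    simp [cutoff_eq_one hε hy.le]
  exact (notMem_tsupport_iff_eventuallyEq.mpr h0) hx

omit [FiniteDimensional ℝ E] [MeasurableSpace E] [BorelSpace E] in
/-- The cut-off `χ_ε` has topological support in the closed ball `B̄_{2ε}` (local copy of
`MildSolutionProofs.tsupport_cutoff_subset`, kept private to avoid the heavy import). [folklore] -/
private theorem cutoff_tsupport_subset_closedBall {ε : ℝ} (hε : 0 < ε) :
    tsupport (cutoff (E := E) ε) ⊆ closedBall (0 : E) (2 * ε) := by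
  refine closure_minimal (fun y hy => ?_) isClosed_closedBall
  rw [mem_closedBall_zero_iff]
  by_contra hy'
  exact hy (cutoff_eq_zero hε (le_of_lt (not_le.1 hy')))

/-- **A point is removable for weakly divergence-free `L²` fields** (`dim E ≥ 3`). If `V` is
measurable with `|V|²` locally integrable and `∫ ⟪V, ∇θ⟫ = 0` for all smooth `θ` compactly
supported in `E ∖ {0}`, then `∫ ⟪V, ∇θ⟫ = 0` for all smooth compactly supported `θ`
(points have zero `2`-capacity in dimension `≥ 3`; cut-off argument, see the module docstring).
[folklore] -/
theorem integral_inner_gradient_eq_zero_of_puncture (hE : 3 ≤ Module.finrank ℝ E) {V : E → E}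
    (hVm : AEStronglyMeasurable V volume) (hV2 : LocallyIntegrable (fun x => ‖V x‖ ^ 2) volume)
    (h : ∀ θ : E → ℝ, FunctionSpaces.IsTestFunctionOn ⟨{x : E | x ≠ 0}, isOpen_ne⟩ θ →
      ∫ x, ⟪V x, gradient θ x⟫ = 0)
    {θ : E → ℝ} (hθ : ContDiff ℝ ∞ θ) (hθc : HasCompactSupport θ) :
    ∫ x, ⟪V x, gradient θ x⟫ = 0 := by
  haveI : Nontrivial E := Module.nontrivial_of_finrank_pos (R := ℝ) (by omega)
  have hV1 : LocallyIntegrable V volume := locallyIntegrable_of_normSq hVm hV2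
  have hθ1 : ContDiff ℝ 1 θ := hθ.of_le (by simp)
  -- bounds on `θ`, `Dθ`, `Dχ`
  obtain ⟨M, hM⟩ := hθc.exists_bound_of_continuous hθ.continuous
  obtain ⟨G, hG⟩ := (hθc.fderiv (𝕜 := ℝ)).exists_bound_of_continuous
    (hθ1.continuous_fderiv one_ne_zero)
  have hM0 : 0 ≤ M := (norm_nonneg _).trans (hM 0)
  have hG0 : 0 ≤ G := (norm_nonneg _).trans (hG 0)
  obtain ⟨C, hC0, hC⟩ := exists_norm_fderiv_cutoff_le (E := E)
  -- the integrand
  set P : E → ℝ := fun x => ⟪V x, gradient θ x⟫ with hP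
  have hPi : Integrable P := integrable_inner_gradient hV1 hθ1 hθc
  -- the fixed majorant
  set H : E → ℝ := fun x =>
    G * ((1 + ‖V x‖ ^ 2) / 2) + C * M * (‖V x‖ ^ 2 + (‖x‖ ^ 2)⁻¹) with hH
  have hHi : IntegrableOn H (closedBall (0 : E) 2) volume := by
    have hV2' : IntegrableOn (fun x => ‖V x‖ ^ 2) (closedBall (0 : E) 2) volume :=
      hV2.integrableOn_isCompact (isCompact_closedBall 0 2)
    have hconst : IntegrableOn (fun _ : E => (1 : ℝ)) (closedBall (0 : E) 2) volume :=
      integrableOn_const (measure_closedBall_lt_top.ne)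
    have hpow : IntegrableOn (fun x : E => (‖x‖ ^ 2)⁻¹) (closedBall (0 : E) 2) volume := by
      refine (integrableOn_ball_of_norm_le_rpow (μ := volume) (r := 3) ?_ (C := 1) (α := 2)
        ?_ ?_ ?_).mono_set (closedBall_subset_ball (by norm_num))
      · omega
      · exact_mod_cast (by omega : 2 < Module.finrank ℝ E)
      · refine Eventually.of_forall fun x => ?_
        rw [norm_inv, norm_pow, norm_norm, one_mul, Real.rpow_neg (norm_nonneg _), Real.rpow_two]
      · exact ((continuous_norm.pow 2).measurable.inv).aestronglyMeasurable
    exact (((hconst.add hV2').div_const 2).const_mul G).add ((hV2'.add hpow).const_mul (C * M))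
  -- the key estimate: for `0 < ε ≤ 1`, `|∫ P| ≤ ∫_{B̄_{2ε}} H`
  have key : ∀ ε : ℝ, 0 < ε → ε ≤ 1 → ‖∫ x, P x‖ ≤ ∫ x in closedBall (0 : E) (2 * ε), H x := by
    intro ε hε hε1
    set ψ : E → ℝ := fun x => (1 - cutoff ε x) * θ x with hψ
    have hψt := isTestFunctionOn_one_sub_cutoff_mul hε hθ hθc
    have h0 : ∫ x, ⟪V x, gradient ψ x⟫ = 0 := h ψ hψt
    have hQi : Integrable (fun x => ⟪V x, gradient ψ x⟫) :=
      integrable_inner_gradient hV1 (hψt.contDiff.of_le (by simp)) hψt.hasCompactSupport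
    have hdom : ∀ᵐ x ∂(volume : Measure E),
        ‖P x - ⟪V x, gradient ψ x⟫‖ ≤ (closedBall (0 : E) (2 * ε)).indicator H x := by
      have hne : ∀ᵐ x ∂(volume : Measure E), x ≠ (0 : E) := by
        rw [ae_iff]
        simp
      filter_upwards [hne] with x hx
      have hχd : HasFDerivAt (cutoff ε) (fderiv ℝ (cutoff ε) x) x :=
        ((contDiff_cutoff (n := 1) ε).differentiable one_ne_zero x).hasFDerivAt
      have hθd : HasFDerivAt θ (fderiv ℝ θ x) x := (hθ1.differentiable one_ne_zero x).hasFDerivAt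
      have hψd : HasFDerivAt ψ
          ((1 - cutoff ε x) • fderiv ℝ θ x + θ x • (-(fderiv ℝ (cutoff ε) x))) x :=
        (hχd.const_sub 1).mul hθd
      have hdiff : P x - ⟪V x, gradient ψ x⟫ =
          cutoff ε x * fderiv ℝ θ x (V x) + θ x * fderiv ℝ (cutoff ε) x (V x) := by
        simp only [hP, inner_gradient_eq_fderiv_apply, hψd.fderiv, _root_.add_apply,
          _root_.smul_apply, _root_.neg_apply, smul_eq_mul]
        ring
      rw [hdiff]
      by_cases hxe : ‖x‖ ≤ 2 * ε
      · rw [indicator_of_mem (mem_closedBall_zero_iff.2 hxe), hH]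
        have hxn : 0 < ‖x‖ := norm_pos_iff.2 hx
        have h1 : |cutoff ε x * fderiv ℝ θ x (V x)| ≤ G * ((1 + ‖V x‖ ^ 2) / 2) := by
          rw [abs_mul]
          have hD : |fderiv ℝ θ x (V x)| ≤ G * ‖V x‖ := by
            rw [← Real.norm_eq_abs]
            exact (ContinuousLinearMap.le_opNorm _ _).trans
              (mul_le_mul_of_nonneg_right (hG x) (norm_nonneg _))
          calc |cutoff ε x| * |fderiv ℝ θ x (V x)| ≤ 1 * (G * ‖V x‖) :=
                mul_le_mul (abs_cutoff_le_one ε x) hD (abs_nonneg _) zero_le_one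
            _ ≤ G * ((1 + ‖V x‖ ^ 2) / 2) := by
                rw [one_mul]
                refine mul_le_mul_of_nonneg_left ?_ hG0
                nlinarith [sq_nonneg (‖V x‖ - 1)]
        have h2 : |θ x * fderiv ℝ (cutoff ε) x (V x)| ≤
            C * M * (‖V x‖ ^ 2 + (‖x‖ ^ 2)⁻¹) := by
          rw [abs_mul]
          have hθx : |θ x| ≤ M := by simpa [Real.norm_eq_abs] using hM x
          have hDx : |fderiv ℝ (cutoff ε) x (V x)| ≤ C / ε * ‖V x‖ := by
            rw [← Real.norm_eq_abs]
            exact (ContinuousLinearMap.le_opNorm _ _).trans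
              (mul_le_mul_of_nonneg_right (hC ε hε x) (norm_nonneg _))
          have hεx : 1 / ε ≤ 2 * ‖x‖⁻¹ := by
            rw [← div_eq_mul_inv, div_le_div_iff₀ hε hxn]
            linarith
          calc |θ x| * |fderiv ℝ (cutoff ε) x (V x)| ≤ M * (C / ε * ‖V x‖) :=
                mul_le_mul hθx hDx (abs_nonneg _) hM0
            _ = C * M * ((1 / ε) * ‖V x‖) := by ring
            _ ≤ C * M * ((2 * ‖x‖⁻¹) * ‖V x‖) := by gcongr
            _ ≤ C * M * (‖V x‖ ^ 2 + (‖x‖ ^ 2)⁻¹) := by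
                refine mul_le_mul_of_nonneg_left ?_ (mul_nonneg hC0 hM0)
                rw [← inv_pow]
                nlinarith [sq_nonneg (‖V x‖ - ‖x‖⁻¹)]
        calc ‖cutoff ε x * fderiv ℝ θ x (V x) + θ x * fderiv ℝ (cutoff ε) x (V x)‖
            ≤ |cutoff ε x * fderiv ℝ θ x (V x)| + |θ x * fderiv ℝ (cutoff ε) x (V x)| := by
              rw [Real.norm_eq_abs]
              exact abs_add_le _ _
          _ ≤ _ := add_le_add h1 h2
      · push Not at hxe
        have hχ0 : cutoff ε x = 0 := cutoff_eq_zero hε hxe.le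
        have hD0 : fderiv ℝ (cutoff ε) x = 0 := by
          apply fderiv_of_notMem_tsupport ℝ
          intro hx'
          exact (not_le.2 hxe) (mem_closedBall_zero_iff.1 (cutoff_tsupport_subset_closedBall hε hx'))
        rw [indicator_of_notMem (fun h' => (not_le.2 hxe) (mem_closedBall_zero_iff.1 h')), hχ0,
          hD0]
        simp
    have hind : Integrable ((closedBall (0 : E) (2 * ε)).indicator H) volume :=
      (hHi.mono_set (closedBall_subset_closedBall (by linarith))).integrable_indicator
        measurableSet_closedBall
    calc ‖∫ x, P x‖ = ‖∫ x, (P x - ⟪V x, gradient ψ x⟫)‖ := by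
          rw [integral_sub hPi hQi, h0, sub_zero]
      _ ≤ ∫ x, (closedBall (0 : E) (2 * ε)).indicator H x := norm_integral_le_of_norm_le hind hdom
      _ = ∫ x in closedBall (0 : E) (2 * ε), H x := integral_indicator measurableSet_closedBall
  -- let `ε = 1/(n+1) → 0`: the closed balls shrink to the null set `{0}`
  have hanti : Antitone fun n : ℕ => closedBall (0 : E) (2 * (1 / ((n : ℝ) + 1))) := by
    intro m n hmn
    apply closedBall_subset_closedBall
    gcongr
  have hlim := tendsto_setIntegral_of_antitone (μ := volume) (f := H)
    (fun n => measurableSet_closedBall) hanti ⟨0, by simpa using hHi⟩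
  have hsub : (⋂ n : ℕ, closedBall (0 : E) (2 * (1 / ((n : ℝ) + 1)))) ⊆ {0} := by
    intro z hz
    rw [mem_iInter] at hz
    rw [mem_singleton_iff, ← norm_le_zero_iff]
    have ht : Tendsto (fun n : ℕ => 2 * (1 / ((n : ℝ) + 1))) atTop (𝓝 0) := by
      simpa using (tendsto_one_div_add_atTop_nhds_zero_nat).const_mul (2 : ℝ)
    exact ge_of_tendsto' ht fun n => mem_closedBall_zero_iff.1 (hz n)
  rw [setIntegral_measure_zero _ (measure_mono_null hsub (measure_singleton _))] at hlim
  have hle : ∀ n : ℕ, ‖∫ x, P x‖ ≤ ∫ x in closedBall (0 : E) (2 * (1 / ((n : ℝ) + 1))), H x :=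
    fun n => key _ (by positivity) (by rw [div_le_one (by positivity)]; linarith)
  exact norm_le_zero_iff.1 (ge_of_tendsto' hlim hle)

/-- **Removable point, tree-predicate form.** Under the hypotheses of
`integral_inner_gradient_eq_zero_of_puncture`, `V` is weakly divergence free on the whole space
(`IsWeaklyDivFree V`). [folklore] -/
theorem isWeaklyDivFree_of_puncture (hE : 3 ≤ Module.finrank ℝ E) {V : E → E}
    (hVm : AEStronglyMeasurable V volume) (hV2 : LocallyIntegrable (fun x => ‖V x‖ ^ 2) volume)
    (h : ∀ θ : E → ℝ, FunctionSpaces.IsTestFunctionOn ⟨{x : E | x ≠ 0}, isOpen_ne⟩ θ →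
      ∫ x, ⟪V x, gradient θ x⟫ = 0) :
    IsWeaklyDivFree V := fun _ hθ =>
  integral_inner_gradient_eq_zero_of_puncture hE hVm hV2 h hθ.contDiff hθ.hasCompactSupport

/-- **Removable point in `ℝ³`, in the form used by point-sink constructions.** Let
`V : ℝ³ → ℝ³` be measurable with `|V|²` locally integrable off the origin and integrable on some
ball `B_r` (e.g. a discretely self-similar `L²_loc` cone, `DSSCone.normSq_integrableOn_ball`), and
weakly divergence free off the origin. Then `∫ ⟪V, ∇θ⟫ = 0` for every smooth compactly supported
`θ`. [folklore] -/
theorem integral_inner_gradient_eq_zero_of_puncture_three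
    {V : EuclideanSpace ℝ (Fin 3) → EuclideanSpace ℝ (Fin 3)} (hVm : AEStronglyMeasurable V volume)
    (hVloc : LocallyIntegrableOn (fun x => ‖V x‖ ^ 2) {x : EuclideanSpace ℝ (Fin 3) | x ≠ 0} volume)
    {r : ℝ} (hr : 0 < r)
    (hVball : IntegrableOn (fun x => ‖V x‖ ^ 2) (ball (0 : EuclideanSpace ℝ (Fin 3)) r) volume)
    (h : ∀ θ : EuclideanSpace ℝ (Fin 3) → ℝ,
      FunctionSpaces.IsTestFunctionOn ⟨{x : EuclideanSpace ℝ (Fin 3) | x ≠ 0}, isOpen_ne⟩ θ →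
        ∫ x, ⟪V x, gradient θ x⟫ = 0)
    {θ : EuclideanSpace ℝ (Fin 3) → ℝ} (hθ : ContDiff ℝ ∞ θ) (hθc : HasCompactSupport θ) :
    ∫ x, ⟪V x, gradient θ x⟫ = 0 :=
  integral_inner_gradient_eq_zero_of_puncture (by rw [finrank_euclideanSpace_fin]) hVm
    (locallyIntegrable_of_puncture hr hVloc hVball) h hθ hθc

end Literature.Analysis.FluidPDE

end
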